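import Literature.AlgebraicGeometry.HodgeTheory.ChernCharacterLawsRigidity
import HarnessLib

/-!
# `stub_span` of the crux line `grothendieck_axiomatic` REDUCES to the span law for ONE lawful non-degenerate character

Route `EightfoldBlochSeeds` (decl of record shared with `EightfoldTwistedSheafSeeds` / `TensorMonadSeeds` /
`FirstOrderSemiregularSeeds` / `VHCAbelianSchemesRoad`), item `stmt-HodgeConjecture-19780` (`ChernCharacterOnBetti`),
helper (`--supports`). HONEST FRAMING: nothing here proves 19780 / 18880 / 18882 / 18883 / H2 / HC_AV / HC_CM / HC, and
`stub_span` itself is NOT proved; no definition, no named fact.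

The registered stub (`Cruxes/ChernCharacterOnBetti/Lines/grothendieck_axiomatic.lean` l.154) reads

  `theorem stub_span : ∀ ch : ChernDatum, IsTopologicalChernCharacter ch → NonDegenerate ch →`
  `    ∀ {n : ℕ} {X : SchemeOver ℂ}, IsSmoothProjective n X → ∀ p : ℕ,`
  `      algebraicClasses X p ≤ Submodule.span ℂ {c | ∃ E : X.left.Modules, IsVectorBundle E ∧ ch X E p = c}`.

By LEMMA U for raw data (`HodgeTheory/ChernCharacterLawsRigidity.span_ch_eq_of_laws`, p835116: two lawful non-degenerate
data have the same spans `ℂ · {ch_p(E)}` in every positive degree on every smooth projective variety) the universally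
quantified stub FOLLOWS from the span law for ANY ONE lawful non-degenerate datum `ch₀` (`stub_span_of_exists_span`); the
degree `p = 0` holds for every datum normalised on free modules (`span_ch_zero_eq_top_of_free_zero`: `H⁰(X(ℂ); ℂ) = ℂ · 1 =
ℂ · ch₀(𝒪_X)`). So the remaining content of `stub_span` is an EXISTENCE statement: one Chern character with Fulton's span
property (Ex. 15.2.16 (b): resolutions + Riemann–Roch without denominators; scoping memo `MEMO-stub_span-hand-19780-g5.md`).

As in `…StubAlgebraicity`, the crux-local predicates `IsTopologicalChernCharacter` / `NonDegenerate` are not importable here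
(CONVENTIONS §2); the laws are taken unbundled in the structure's field order, and the skeleton glue is
`fun ch h hnd _ _ hX p => stub_span_of_exists_span ⟨ch₀, …⟩ ch h.ch_congr h.ch_shortExact h.map_ch h.ch_free_zero`
`h.ch_free_of_pos h.ch_of_hasRankLE_one hnd hX p`.

[cite: Grothendieck1958, Thm. 1 (uniqueness)] [cite: Fulton1998, Example 15.2.16 (b)] [cite: Deligne2000, §2 Remark (ii)]
-/

noncomputable section

-- single-problem summit (Problem = Summit): the mandated namespace repeats `HodgeConjecture`.
set_option linter.dupNamespace false

open CategoryTheory AlgebraicGeometry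
open Literature.AlgebraicGeometry.Motives Literature.AlgebraicGeometry.HodgeTheory
open Literature.AlgebraicTopology.SingularHomology

namespace Summit.HodgeConjecture.HodgeConjecture.Theorems

/-- **Degree `0` of the span law, for every datum normalised on free modules**: on a smooth projective (hence connected)
`X`, `H⁰(X(ℂ); ℂ) = ℂ · 1` and `1 = ch₀(𝒪_X^{PUnit})`, so every class of degree `0` is in `ℂ · {ch₀(E)}`.
[cite: Fulton1998, Example 3.2.3] [cite: HatcherAT2002, §3.1 p. 199] -/
theorem span_ch_zero_eq_top_of_free_zero
    (ch : ∀ (X : SchemeOver ℂ) (E : X.left.Modules) (i : ℕ), complexBetti X (2 * i))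
    (h_free_zero : ∀ (X : SchemeOver ℂ) (I : Type) [Finite I],
      ch X (SheafOfModules.free (R := X.left.ringCatSheaf) I) 0 = (Nat.card I : ℂ) • singularCohomology.one ℂ (ComplexPoints X))
    {n : ℕ} {X : SchemeOver ℂ} (hX : IsSmoothProjective n X) :
    Submodule.span ℂ {c | ∃ E : X.left.Modules, IsVectorBundle E ∧ ch X E 0 = c} = ⊤ := by
  refine eq_top_iff.2 fun x _ ↦ ?_
  obtain ⟨c, rfl⟩ := exists_eq_smul_one_of_isSmoothProjective hX ℂ x
  have h1 : ch X (SheafOfModules.free (R := X.left.ringCatSheaf) PUnit) 0 = singularCohomology.one ℂ (ComplexPoints X) := by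
    rw [h_free_zero X PUnit]
    simp
  rw [← h1]
  exact Submodule.smul_mem _ _ (Submodule.subset_span ⟨_, isVectorBundle_free PUnit, rfl⟩)

/-- **`stub_span` ⟸ the span law for ONE lawful non-degenerate character.** If some datum `ch₀` — invariant under
isomorphism, additive on short exact sequences of vector bundles, functorial along `ℂ`-morphisms, vanishing in positive
degrees on free modules, exponential on rank `≤ 1`, non-degenerate — satisfies `Nᵖ H²ᵖ(X(ℂ); ℂ) ⊆ ℂ · {ch₀_p(E)}` for every
smooth projective `X` and every `p ≥ 1`, then EVERY datum `ch` with the nine topological laws of the crux line (here the six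
used: the five above and `ch₀(𝒪^I) = #I`) that is non-degenerate satisfies the span law in every degree — LEMMA U for raw
data (`span_ch_eq_of_laws`) in positive degrees, `span_ch_zero_eq_top_of_free_zero` in degree `0`.
[cite: Grothendieck1958, Thm. 1 (uniqueness)] [cite: Fulton1998, Example 15.2.16 (b)] [cite: Deligne2000, §2 Remark (ii)] -/
theorem stub_span_of_exists_span
    (hex : ∃ ch₀ : (∀ (X : SchemeOver ℂ) (E : X.left.Modules) (i : ℕ), complexBetti X (2 * i)),
      (∀ {X : SchemeOver ℂ} {E F : X.left.Modules} (_ : E ≅ F) (i : ℕ), ch₀ X E i = ch₀ X F i) ∧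
      (∀ {X : SchemeOver ℂ} (S : ShortComplex X.left.Modules), S.ShortExact →
        IsVectorBundle S.X₁ → IsVectorBundle S.X₃ → ∀ i : ℕ, ch₀ X S.X₂ i = ch₀ X S.X₁ i + ch₀ X S.X₃ i) ∧
      (∀ {X Y : SchemeOver ℂ} (f : Y ⟶ X) (E : X.left.Modules), IsVectorBundle E →
        ∀ i : ℕ, complexBetti.map f (2 * i) (ch₀ X E i) = ch₀ Y ((Scheme.Modules.pullback f.left).obj E) i) ∧
      (∀ (X : SchemeOver ℂ) (I : Type) [Finite I] {i : ℕ}, 0 < i →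
        ch₀ X (SheafOfModules.free (R := X.left.ringCatSheaf) I) i = 0) ∧
      (∀ {X : SchemeOver ℂ} {L : X.left.Modules}, HasRankLE L 1 →
        ∀ {i : ℕ}, 0 < i → ch₀ X L i = ((Nat.factorial i : ℕ) : ℂ)⁻¹ • cupPowTwo (ch₀ X L 1) i) ∧
      (∃ (N : ℕ) (L : (projectiveSpace N ℂ).left.Modules), HasRankLE L 1 ∧ ch₀ (projectiveSpace N ℂ) L 1 ≠ 0) ∧
      (∀ {n : ℕ} {X : SchemeOver ℂ}, IsSmoothProjective n X → ∀ {p : ℕ}, 0 < p →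
        algebraicClasses X p ≤ Submodule.span ℂ {c | ∃ E : X.left.Modules, IsVectorBundle E ∧ ch₀ X E p = c})) :
    ∀ ch : (∀ (X : SchemeOver ℂ) (E : X.left.Modules) (i : ℕ), complexBetti X (2 * i)),
      (∀ {X : SchemeOver ℂ} {E F : X.left.Modules} (_ : E ≅ F) (i : ℕ), ch X E i = ch X F i) →
      (∀ {X : SchemeOver ℂ} (S : ShortComplex X.left.Modules), S.ShortExact →
        IsVectorBundle S.X₁ → IsVectorBundle S.X₃ → ∀ i : ℕ, ch X S.X₂ i = ch X S.X₁ i + ch X S.X₃ i) →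
      (∀ {X Y : SchemeOver ℂ} (f : Y ⟶ X) (E : X.left.Modules), IsVectorBundle E →
        ∀ i : ℕ, complexBetti.map f (2 * i) (ch X E i) = ch Y ((Scheme.Modules.pullback f.left).obj E) i) →
      (∀ (X : SchemeOver ℂ) (I : Type) [Finite I],
        ch X (SheafOfModules.free (R := X.left.ringCatSheaf) I) 0 =
          (Nat.card I : ℂ) • singularCohomology.one ℂ (ComplexPoints X)) →
      (∀ (X : SchemeOver ℂ) (I : Type) [Finite I] {i : ℕ}, 0 < i →
        ch X (SheafOfModules.free (R := X.left.ringCatSheaf) I) i = 0) →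
      (∀ {X : SchemeOver ℂ} {L : X.left.Modules}, HasRankLE L 1 →
        ∀ {i : ℕ}, 0 < i → ch X L i = ((Nat.factorial i : ℕ) : ℂ)⁻¹ • cupPowTwo (ch X L 1) i) →
      (∃ (N : ℕ) (L : (projectiveSpace N ℂ).left.Modules), HasRankLE L 1 ∧ ch (projectiveSpace N ℂ) L 1 ≠ 0) →
      ∀ {n : ℕ} {X : SchemeOver ℂ}, IsSmoothProjective n X → ∀ p : ℕ,
        algebraicClasses X p ≤ Submodule.span ℂ {c | ∃ E : X.left.Modules, IsVectorBundle E ∧ ch X E p = c} := by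
  obtain ⟨ch₀, h0_congr, h0_shortExact, h0_map, h0_free, h0_exp, h0nd, h0span⟩ := hex
  intro ch h_congr h_shortExact h_map h_free_zero h_free h_exp hnd n X hX p
  rcases Nat.eq_zero_or_pos p with rfl | hp
  · rw [span_ch_zero_eq_top_of_free_zero ch h_free_zero hX]
    exact le_top
  · rw [span_ch_eq_of_laws ch₀ ch h0_congr h0_shortExact h0_map h0_free h0_exp h0nd h_congr h_shortExact h_map h_free
      h_exp hnd hX hp]
    exact h0span hX hp

end Summit.HodgeConjecture.HodgeConjecture.Theorems

end
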